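import Mathlib
import HarnessLib
import HarnessLib.Audit
import Summits.CriticalPhenomena.Statement
import Summits.CriticalPhenomena.SAWScalingLimit.Theorems.SAWTotalPositivityBoundaryHarnackConverse

/-!
Route: SubPtolemyInterlacing

DORMANT since 2026-09-03T09:44:27Z (reconciler: no traction for 5 d (last activity statement-checked at 2026-08-29T09:07:13Z); parked, not closed — `ledger route dormant route-CriticalPhenomena-SubPtolemyInterlacing --off` to reactivate) — unstaffed, not closed; items shared with open routes are served there. `ledger route dormant <id> --off` reactivates.

# Route SubPtolemyInterlacing — Ptolemy is a four-spin inequality — interlacing + an axial floor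
below log2(1+sqrt2) force U4 nonzero on Z^3

It suffices to show X = (SPC) ∧ (FLOOR) ∧ (ML), realising idea card sub-ptolemy-interlacing-u4
("Ptolemy is a four-spin
inequality"; graded new-mechanism by the mechanism critic, 2026-08-16) in a leaner assembly than the
card's. (SPC) Interlacing: at
β_c(3), for every interlaced axis quadruple 0 < a < a+b < a+b+c on the e₁-axis of ℤ³, the critical
spin correlations obey the
sub-Ptolemy inequality S₄(0,a,a+b,a+b+c)·G(0,a+b)·G(a,a+b+c) ≤
G(0,a)·G(a+b,a+b+c)·G(0,a+b+c)·G(a,a+b) (crossing pairing ×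
four-point ≤ product of the two non-crossing pairings; EQUALITY for the planar Ising CFT on every
line/circle = Ptolemy's theorem,
strict on the critical square lattice, violated by the ℤ³ lattice GFF). (FLOOR) SubPtolemyFloor: the
axial critical two-point
function is bounded below by c·n^{-a} for some a < log₂(1+√2) = 1.2716 (i.e. η(3) < 0.2716; truth
0.036). (ML) MoebiusLimit: the
conjunct minus clause (iii) (item stmt-CriticalPhenomena-1344 verbatim, imported from the covariance
routes). Given a witness
(ρ,Δ,S) of (ML), (SPC) passes to the limit at the configuration (0,2,3,6)·e₁ (where d₁₂d₃₄ = d₁₄d₂₃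
= 6, d₁₃d₂₄ = 12: the
Ptolemy-balanced point) and reads S₄ ≤ κ²3^{-2Δ}, while the Wick sum is κ²(2·6^{-2Δ} + 12^{-2Δ});
(FLOOR) and the dyadic
transfer give 2Δ ≤ a < log₂(1+√2), exactly the range where 2·2^{-2Δ} + 4^{-2Δ} > 1, so
U₄((0,2,3,6)e₁) < 0 and clause (iii)
holds. The passage (SPC)+(FLOOR) ⇒ U₄ ≢ 0 for every translation-invariant scale-covariant
non-degenerate pointwise limit is the
provable-now item InterlacingForcesU4 (filed as a crux only because the deciding theorem may assume
cruxes only).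
Lean: `Summit.CriticalPhenomena.Ising3DConformalLimit.Theses.SubPtolemyInterlacing.Interlacing ∧
Summit.CriticalPhenomena.Ising3DConformalLimit.Theses.SubPtolemyInterlacing.SubPtolemyFloor ∧
Summit.CriticalPhenomena.Ising3DConformalLimit.Theses.SubPtolemyInterlacing.MoebiusLimit` (the three
decls below; each elaborates in the planner's Sketch.lean, rc 0, with a sorry-free proof
`assembly_holds` of the Assembly, axioms propext/Classical.choice/Quot.sound)

## Assembly
Pure logic (sorry-free in the planner's Sketch.lean, `assembly_holds`, and in glue.lean, `closes`):
take the witness (ρ, Δ, S) of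
MoebiusLimit; InterlacingForcesU4 applied to Interlacing, SubPtolemyFloor, ρ, Δ, S, positivity of ρ,
the limit, non-degeneracy,
IsTranslationInvariant S (= hmob.1.1) and IsScaleCovariant Δ S (= hmob.2.1) gives HasNontrivialU4 S;
the tuple
⟨ρ, Δ, S, ρ > 0, Δ > 0, limit, non-degeneracy, Möbius covariance, U₄ ≢ 0⟩ is
Literature.Probability.LatticeModels.CritIsing3DConformalLimit,
i.e. `_root_.Ising3DConformalLimit` by name. Rotation invariance and inversion covariance of S are
never used by this route.

Rationale: WHY THIS LINE. Every route in hand that attacks clause (iii) either lower-bounds a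
MERGING/INTERSECTION probability of two sourced currents
(FKParityRobustness, EnergyNotSigmaSquared, PerfectScreening's Coulomb branch,
LatticeSDPCertificates via the top-heavy bubble), or
reads non-Gaussianity off a thermodynamic/spectral face (GammaForcesInteraction, LeeYangGap,
PlantedPinning, OctaveForgetting), or
off η > 0 plus a rigidity theorem for Gaussian limits (AnomalousForcesInteraction;
CanonicalBranchRefutation is its negation-shaped
twin at Δ = 1/2). This line uses none of these: its lever is a NEW CORRELATION INEQUALITY
transplanted from metric Möbius geometry
(Ptolemy's theorem d₁₃d₂₄ = d₁₂d₃₄ + d₁₄d₂₃ on the concyclic locus, Schoenberg's "Ptolemaic ⇒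
Euclidean"; dictionary: distance
product of a pairing ↦ pairing weight ⟨σσ⟩⟨σσ⟩, cyclic order ↦ the crossing pairing (13)(24)),
sitting strictly between GKS-II
(S₄ ≥ each pairing) and Lebowitz1974 (S₄ ≤ sum of pairings, AizenmanCMP1982's Q ≥ 1/3) — the
pairing-SUM sandwich is
dimension-uniform and blind to (iii), whereas the pairing-QUOTIENT inequality is false for the ℤ³
GFF (Wick exceeds it by 19–25 % on
lines) and therefore carries interaction-specific content; its continuum face g(z,z) ≤ (1−z)^{−2Δ}
on the real diagonal is an
identity for the planar Ising CFT (DiFrancescoMathieuSenechal1997 §12, BPZ four-spin function) and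
holds with a 15 % margin for the
3D bootstrap data (arXiv:1612.02436). The dimension dependence that the triviality barrier demands
enters through ONE two-point
number: SPC forces U₄ < 0 exactly when 2Δ < log₂(1+√2) (true in d = 2, 3; false in d ≥ 4 where Δ ≥
1), so the second crux is a
two-point LOWER bound (η < 0.2716), the kind of statement where the ℤ³ toolbox is sharpest
(Simon1980–Lieb, MMS, DuminilcopinPanis2025's
reflected currents give η ≤ 1/2 conditionally) — no intersection exponent, no FK event, no Markov/OS
rigidity, no expansion.
Imported areas: metric Möbius geometry (Ptolemy/Schoenberg) for the shape of the inequality; exact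
planar solvability (Toeplitz row
correlators, BPZ) only as calibration; the imported complement (ML) from the covariance routes as in
eight sibling routes.

RANKED CRUXES. #2 Interlacing (crux) — (SPC, card K1) at β = β_c(3), for all a, b, c ≥ 1, with p(k)
:= k·e₁ ∈ ℤ³: ⟨σ_{p0}σ_{pa}σ_{p(a+b)}σ_{p(a+b+c)}⟩·⟨σ_{p0}σ_{p(a+b)}⟩⟨σ_{pa}σ_{p(a+b+c)}⟩ ≤
⟨σ_{p0}σ_{pa}⟩⟨σ_{p(a+b)}σ_{p(a+b+c)}⟩·⟨σ_{p0}σ_{p(a+b+c)}⟩⟨σ_{pa}σ_{p(a+b)}⟩ in the critical +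
state (criticalCorr 3); equivalently third-order supermodularity of interval domain-wall parities,
or p_cross(1+q) ≤ p_s·p_t for the four-source double current. [difficulty: L] (why it might fail:
equality in the 2D continuum, FALSE for β > β_c and for the ℤ³ GFF — so no GKS/RP-cone or
graph-general switching identity proves it; one lattice-scale sign slip at a small (a,b,c) kills the
all-gaps form (MC 12³–24³: all collinear ρ ≤ 0.97; the eventual form keeps the payoff).)
[Lebowitz1974, AizenmanCMP1982, Newman1975, arXiv:1612.02436, DiFrancescoMathieuSenechal1997]
#3 SubPtolemyFloor (crux) — (FLOOR, the card's K3 in its weakest axial form) there are a <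
log₂(1+√2) ≈ 1.2716 and c > 0 with ⟨σ₀σ_{n e₁}⟩⁺_{β_c(3)} ≥ c·n^{-a} for all n ≥ 1 — i.e. η(3) <
0.2716 as a one-sided power bound along the axis (truth: 2Δ_σ = 1.0363); the threshold is the exact
Gaussian threshold of SPC at the Ptolemy-balanced configuration (2·2^{-2Δ} + 4^{-2Δ} > 1 ⇔ 2Δ <
log₂(1+√2)), not a tunable constant. [difficulty: open-problem] (why it might fail: the best
unconditional floor is Simon–Lieb's c·n^{-2} (η ≤ 1) and the best conditional one η ≤ 1/2
(Duminil-Copin–Panis 2025, assuming η exists); reaching any exponent below 1.2716 needs a new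
lower-bound idea for critical correlations on ℤ³ (physically a factor 7 of room, rigorously none
yet).) [DuminilcopinPanis2025, Simon1980, KosPolandSimmonsDuffinVichi2016, DuminilCopinICM2022]
#4 MoebiusLimit (crux) — (ML, IMPORTED COMPLEMENT = item stmt-CriticalPhenomena-1344 verbatim,
shared with AnomalousForcesInteraction / EnergyNotSigmaSquared / FKParityRobustness /
GammaForcesInteraction / LatticeSDPCertificates / PerfectScreening / PlantedPinning / LeeYangGap)
the conjunct minus clause (iii): there are ρ > 0 on (0,1], Δ > 0 and S with HasPointwiseScalingLimit
(criticalCorr 3) ρ S, non-degenerate two-point function and IsMoebiusCovariant Δ S. Only translation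
invariance and scale covariance of S are used by this route. [difficulty: open-problem] (why it
might fail: existence of the limit, rotation invariance and inversion covariance are each open on ℤ³
(Duminil-Copin ICM 2022 §8.4); Euclidean + scale data alone do not force Möbius covariance (barrier
ScaleCovarianceNotMoebius) — delivered, if at all, by the covariance routes.) [DuminilCopinICM2022,
Literature.Barriers.CriticalPhenomena.ScaleCovarianceNotMoebius, stmt-CriticalPhenomena-1344]
#5 InterlacingForcesU4 (crux) — (provable now; filed as a crux only because the deciding theorem may
assume cruxes only) Interlacing → SubPtolemyFloor → for every renormalisation ρ > 0 on (0,1], every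
Δ and every pointwise scaling limit S of criticalCorr 3 that is non-degenerate, translation
invariant and scale covariant with dimension Δ: HasNontrivialU4 S. Proof: SPC at the lattice
approximants of x⁎ = (0,2,3,6)·e₁ (gaps ⌊2/δ⌋, ⌊3/δ⌋−⌊2/δ⌋, ⌊6/δ⌋−⌊3/δ⌋ ≥ 1 for δ ≤ 1) × ρ(δ)⁸
passes to the limit; translation + scale covariance give S₂ = κ·d^{-2Δ} on the axis (κ > 0), hence
S₄(x⁎) ≤ κ²3^{-2Δ} and U₄(x⁎) ≤ κ²3^{-2Δ}(1 − 2·2^{-2Δ} − 4^{-2Δ}); the dyadic argument of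
scalingDimension_mem_Icc_holds run with the floor (ρ(1/n)²G(n e₁) → κ, G(2n e₁)/G(n e₁) → 2^{-2Δ},
G(2^k N e₁) ≥ c(2^k N)^{-a}) gives 2Δ ≤ a < log₂(1+√2), where 2·2^{-2Δ} + 4^{-2Δ} > 1; so U₄(x⁎) <
0. [deps: Interlacing, SubPtolemyFloor] [difficulty: provable-now] (why it might fail: only through
a formalisation gap — the latticeApprox bookkeeping (⌊k/δ⌋·e₁), limits of products along 𝓝[>]0 and
the dyadic ratio argument must be redone for a lower bound (the in-tree
scalingDimension_mem_Icc_of_bounds does both directions for exponents 1 and 2); mathematically a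
theorem.) [DuminilCopinICM2022, Simon1980, AizenmanCMP1982]
#9 InterlacingSubcritical (support) — (stronger, finite-volume-friendly form of SPC for idle
provers/refuters) for every 0 ≤ β < β_c(3) and all a, b, c ≥ 1 the same interlacing inequality holds
for the plus-state correlations ⟨σ_A⟩⁺_{β,0} on the axis quadruple (0, a, a+b, a+b+c)·e₁ — the
regime with exponential decay, box limits and the random-current/OZ toolbox, where the current form
p_cross(1+q) ≤ p_s·p_t is a disjoint-occurrence statement. [difficulty: L] [AizenmanCMP1982,
Lebowitz1974, FriedliVelenik2017]
#9 SubcriticalSuffices (support) — (provable now) InterlacingSubcritical → Interlacing: plus-state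
correlations of finite spin sets are left-continuous at β_c(3) — ⟨σ_A⟩^free_β ≤ ⟨σ_A⟩⁺_β ≤
⟨σ_A⟩⁺_{β_c} for β < β_c (GKS monotonicity in β), the free state is a supremum of continuous
non-decreasing box functions hence left-continuous, and free = plus at β_c
(criticalCorr_wellDefined_holds / uniqueness at β_c, AizenmanDuminilCopinSidoraviciusCMP2015) — so
the non-strict inequality passes to β_c; spinMonomial of four distinct axis sites = spinProduct of
the 4-set. [difficulty: provable-now] [AizenmanDuminilCopinSidoraviciusCMP2015, FriedliVelenik2017]

TWO-LAYER PLAN. Foreseen glued splits once something closes: Interlacing ⇐ InterlacingSubcritical →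
SubcriticalSuffices → Interlacing (filed as
supports already; a prover may propose the split); Interlacing ⇐ CurrentPairingForm (p_cross(1+q) ≤
p_s p_t for the four-source
double current in finite volume, all β) → BoxToState → Interlacing; SubPtolemyFloor ⇐ (η exists as a
power, shared with the
doubling / Helson / Fekete items) → (η < 0.2716 given existence, an upgraded Duminil-Copin–Panis
bound) → SubPtolemyFloor.

KILL CRITERIA. A proof of ¬Interlacing at ONE axis quadruple (a,b,c) at β_c(3) refutes the rank-2
crux: if the witness is small (a+b+c ≤ 6) pivot to the
EVENTUAL form (∃ N₀, gaps ≥ N₀ — all InterlacingForcesU4 needs) by `--restate`; a structural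
refutation at all scales closes the route
`refuted:Interlacing` and the card with it. A proof of η(3) ≥ 0.2716 (¬SubPtolemyFloor) closes the
route outright (no weaker floor feeds
the Ptolemy threshold). ¬MoebiusLimit refutes the conjunct itself. Item stmt-CriticalPhenomena-0636
(U₄ ≢ 0 for every non-degenerate
limit) proved elsewhere moots the route's (iii)-content but not the inequality.

NOT DECOMPOSED YET. The current/parity reformulations of SPC (third-order supermodularity of
interval parities; p_cross(1+q) ≤ p_s p_t), SPC on general
lattice lines and circles (the concyclic locus), the planar certified check (Toeplitz minors at
β_c(2)) and the high-temperature
leading-order strictness are NOT filed: they are layer-2 children or evidence, not antecedents of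
`closes`. The existence/covariance half
is imported whole (ML) and deliberately not decomposed here — nine covariance routes own it.

CHEAPEST FALSIFIER. One Wolff/Swendsen–Wang run at β_c(3) = 0.221654626 on 48³–64³ measuring
ρ(a,b,c) = S₄·G(a+b)G(b+c)/(G(a)G(c)G(a+b+c)G(b)) for
(2,1,3)·k, (1,1,1)·k, (1,1,2)·k with spans ≤ L_box/4 (torus zero mode pushes ρ → ⟨M⁴⟩/⟨M²⟩² ≈ 1.6 at
spans ~ L_box/2): one ρ
significantly > 1 at spans ≪ L_box kills Interlacing at that scale. The card's author ran 12³–24³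
(all collinear ρ ≤ 0.97, low-T
control β = 0.235 fails as predicted) and the exact 2D Toeplitz check (strict at all 20 gap
triples); this planner queued the same
estimator as kit job spc-smoke j018612 (8³, pipeline check) and the 48³/64³ production runs (ids in
NOTES.md on resume). Continuum
one-liner anyone can redo: 3D Ising needs g(½,½) ≤ 2^{2Δσ} = 2.051 (bootstrap ≈ 1.75).

NUMBERS. Δ_σ = 0.5181489(10) (KosPolandSimmonsDuffinVichi2016), so 2Δ = 1.0363 against the threshold
log₂(1+√2) = 1.27155 (η-threshold
0.2716); rigorous: 1 ≤ 2Δ ≤ 2 for any such limit (scalingDimension_mem_Icc_holds), η ≤ 1/2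
conditional (DuminilcopinPanis2025). At the
balanced configuration (0,2,3,6)e₁ with 2Δ = 1.0363: S₄ ≤ κ²·3^{-1.0363} = 0.320κ², Wick =
κ²(2·6^{-1.0363} + 12^{-1.0363}) = 0.388κ²,
so U₄/G₁₃G₂₄ ≤ −0.87 (bootstrap value of the same ratio ≈ −2·P[merge] at this geometry is more
negative still). MC (card): ρ(2,1,3)
= 0.833(4), ρ(1,1,1) = 0.843(2), ρ(3,3,3) = 0.948(12) on 24³ at β_c. Items at open: 7 (4 crux, 2
support, 1 assembly).

DEFINITION REQUESTS. None: criticalCorr, criticalTwoPoint, plusCorr, criticalBeta, Site, CorrFamily,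
HasPointwiseScalingLimit, IsNondegenerateTwoPoint,
IsTranslationInvariant, IsScaleCovariant, IsMoebiusCovariant, HasNontrivialU4 exist
(Literature.Probability.LatticeModels); Real.logb,
Real.sqrt, Pi.single, Matrix.vecCons from Mathlib. Cite-fact wanted later (not blocking): BPZ/DMS
§12 planar four-spin formula as the
equality calibration.

Novelty: Searches (2026-08-16): all 43 open route theses of the sub read (levers listed in NOTES.md); `ledger
idea list --sub Ising3DConformalLimit
--status all` (121 cards; the 8 open new-mechanism cards read in full); `ledger negatives --problem
CriticalPhenomena` (10, none on Ising₃);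
`lit search --source crossref "Ptolemy inequality correlation functions Ising"` (10 rows: McCoy–Wu
ch. VII, Hecht 1967, Au-Yang 1977
multispin formulas — planar exact results, no inequality); `lit galaxy search "Ptolemy inequality"
--star all` (15 rows: olympiad /
metric-geometry texts, arXiv:2204.11443 Markov numbers — nothing on spin systems); `lit galaxy
search "four-spin correlation" --star
all` (20 rows: textbooks, 2D Potts bootstrap arXiv:1809.02191 — no pairing-quotient inequality);
`lit search --source zbmath "Ising
correlation inequality four-point Lebowitz Griffiths upper bound"` (0); `lit search --source arxiv
"Ising correlation inequality four
spin quadruple collinear"` (0); OpenAlex 429 (budget exhausted), searchd hybrid down (connection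
reset) — logged; the card's and the
critic's own searches (openalex ×1, zbMATH ×2, hybrid local ×1, galaxy bm25 ×2) found nothing
either.
Nearest prior art found: Lebowitz1974 / GKS-II / AizenmanCMP1982 (pairing-SUM sandwich 1/3 ≤ Q ≤ 1,
dimension-uniform); Newman1975
(hafnian/Gaussian upper bounds); arXiv:1612.02436 (numerical Q(u,v) of the 3D Ising CFT, no
inequality); nearest ROUTE:
AnomalousForcesInteraction (same logical slot "two-point exponent + a  [refs: 2204.11443, 1809.02191, 1612.02436, Lebowitz1974, AizenmanCMP1982, Newman1975]

Barriers (technique_class: correlation-inequality, gaussian-threshold, ptolemy): - technique_class: correlation-inequality, gaussian-threshold, ptolemy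
- Literature.Barriers.CriticalPhenomena.IsingTrivialityFromDimensionFour: evaded — SPC is
(conjecturally) dimension-uniform but SPC ⇒ U₄ ≢ 0 holds exactly when 2Δ(d) < log₂(1+√2), true for d
= 2, 3 and false for d ≥ 4 (Δ ≥ 1, where Gaussian fields satisfy SPC); the dimension dependence sits
in the two-point crux SubPtolemyFloor, outside the class of dimension-uniform arguments by
construction.
- Literature.Barriers.CriticalPhenomena.LongRangeTrivialityOnZ3: evaded the same way — for the
reflection-positive long-range members with α ≤ 3/2 one has Δ = (3−α)/2 ≥ 3/4 > 0.636, so the floor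
fails there and SPC yields nothing, consistent with their Gaussianity; nothing interaction-uniform
is claimed.
- Literature.Barriers.CriticalPhenomena.BootstrapLatticeBlindness: not in class — both cruxes are
lattice statements about criticalCorr / criticalTwoPoint; the continuum face g(z,z) ≤ (1−z)^{−2Δ} is
NOT a universal CFT bound (the generalised free field with Δ = 0.518 violates it), so no
lattice-blind derivation exists or is claimed; bootstrap numbers are only the cheapest falsifier.
- Literature.Barriers.CriticalPhenomena.TransverseCrossingsNeedNotMeet: evaded — no intersection or
merging of paths/currents is lower-bounded; the interlacing order only indexes where the inequality
is sharp.
- Literature.Barriers.CriticalPhenomena.ScaleCovarianceNotMoebius / LiouvilleRigidity /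
TwoPointLawNotMoebius: not engaged — claus

History (route lifecycle, newest last):
- 2026-08-26T03:36:20Z · DORMANT — reconciler: no traction for 8.3 d (last activity item-evidence-added at 2026-08-17T19:20:22Z); parked, not closed — `ledger route dormant route-CriticalPhenomen (operator:999:2228651)
- 2026-08-27T19:38:53Z · REACTIVATED — reconciler: reactivated — activity statement-checked at 2026-08-27T17:30:33Z after parking at 2026-08-26T03:36:20Z (operator:999:90343)
- 2026-08-29T19:35:54Z · DORMANT — census g0: costume|duplicate of —; reader census-reader-39-g0 (operator:999:1375204)
- 2026-08-29T21:06:57Z · REACTIVATED — census: dormancy REVERTED — g1 reader + census-trib-costume-C class it NOT-COSTUME (21-frontier 20:08:25Z: no single-read elimination) (operator:999:2001340)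
- 2026-09-03T09:44:27Z · DORMANT — reconciler: no traction for 5 d (last activity statement-checked at 2026-08-29T09:07:13Z); parked, not closed — `ledger route dormant route-CriticalPhenomena-Su (operator:999:3951740)

sub-problem: Ising3DConformalLimit · status: dormant · opened planner-plan-novel-CriticalPhenomena-Ising3DCon-3ad144fc-v2-0 2026-08-16T15:52:45Z · rev 2 · ledger route-CriticalPhenomena-SubPtolemyInterlacing
GENERATED by the gate from the ledger (D-0016/17). Provers cite these decls: `theorem foo : Summit.CriticalPhenomena.Ising3DConformalLimit.Theses.SubPtolemyInterlacing.<Decl> := …` in Summits/CriticalPhenomena/Ising3DConformalLimit/Theorems/<Name>.lean.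
-/

namespace Summit.CriticalPhenomena.Ising3DConformalLimit.Theses.SubPtolemyInterlacing

open scoped BigOperators Topology Manifold Classical MeasureTheory ProbabilityTheory Matrix InnerProductSpace ComplexConjugate ContinuousMap
open Filter Set Function TopologicalSpace MeasureTheory

attribute [summit_statement] _root_.Ising3DConformalLimit

/-- item stmt-CriticalPhenomena-15702 · crux · rank 2 · open · by planner
why it might fail: equality in the 2D continuum, FALSE for β > β_c and for the ℤ³ GFF — so no GKS/RP-cone or graph-general switching identity proves it; one lattice-scale sign slip at a small (a,b,c) kills the all-gaps form (MC 12³–24³: all collinear ρ ≤ 0.97; the eventual form keeps the payoff).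
sources: Lebowitz1974, AizenmanCMP1982, Newman1975, arXiv:1612.02436, DiFrancescoMathieuSenechal1997
[crux] (SPC, card K1) at β = β_c(3), for all a, b, c ≥ 1, with p(k) := k·e₁ ∈ ℤ³:
⟨σ_{p0}σ_{pa}σ_{p(a+b)}σ_{p(a+b+c)}⟩·⟨σ_{p0}σ_{p(a+b)}⟩⟨σ_{pa}σ_{p(a+b+c)}⟩ ≤
⟨σ_{p0}σ_{pa}⟩⟨σ_{p(a+b)}σ_{p(a+b+c)}⟩·⟨σ_{p0}σ_{p(a+b+c)}⟩⟨σ_{pa}σ_{p(a+b)}⟩ in the critical +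
state (criticalCorr 3); equivalently third-order supermodularity of interval domain-wall parities,
or p_cross(1+q) ≤ p_s·p_t for the four-source double current. [difficulty: L] -/
@[route_item "route-CriticalPhenomena-SubPtolemyInterlacing"]
def Interlacing : Prop :=
  ∀ a b c : ℕ, 1 ≤ a → 1 ≤ b → 1 ≤ c → let p : ℕ → Literature.Probability.LatticeModels.Site 3 := fun k => (k : ℤ) • (Pi.single 0 1 : Literature.Probability.LatticeModels.Site 3); Literature.Probability.LatticeModels.criticalCorr 3 4 ![p 0, p a, p (a + b), p (a + b + c)] * (Literature.Probability.LatticeModels.criticalCorr 3 2 ![p 0, p (a + b)] * Literature.Probability.LatticeModels.criticalCorr 3 2 ![p a, p (a + b + c)]) ≤ Literature.Probability.LatticeModels.criticalCorr 3 2 ![p 0, p a] * Literature.Probability.LatticeModels.criticalCorr 3 2 ![p (a + b), p (a + b + c)] * (Literature.Probability.LatticeModels.criticalCorr 3 2 ![p 0, p (a + b + c)] * Literature.Probability.LatticeModels.criticalCorr 3 2 ![p a, p (a + b)])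

/-- item stmt-CriticalPhenomena-15703 · crux · rank 3 · open · by planner
why it might fail: the best unconditional floor is Simon–Lieb's c·n^{-2} (η ≤ 1) and the best conditional one η ≤ 1/2 (Duminil-Copin–Panis 2025, assuming η exists); reaching any exponent below 1.2716 needs a new lower-bound idea for critical correlations on ℤ³ (physically a factor 7 of room, rigorously none yet).
sources: DuminilcopinPanis2025, Simon1980, KosPolandSimmonsDuffinVichi2016, DuminilCopinICM2022
[crux] (FLOOR, the card's K3 in its weakest axial form) there are a < log₂(1+√2) ≈ 1.2716 and c > 0
with ⟨σ₀σ_{n e₁}⟩⁺_{β_c(3)} ≥ c·n^{-a} for all n ≥ 1 — i.e. η(3) < 0.2716 as a one-sided power bound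
along the axis (truth: 2Δ_σ = 1.0363); the threshold is the exact Gaussian threshold of SPC at the
Ptolemy-balanced configuration (2·2^{-2Δ} + 4^{-2Δ} > 1 ⇔ 2Δ < log₂(1+√2)), not a tunable constant.
[difficulty: open-problem] -/
@[route_item "route-CriticalPhenomena-SubPtolemyInterlacing"]
def SubPtolemyFloor : Prop :=
  ∃ a c : ℝ, a < Real.logb 2 (1 + Real.sqrt 2) ∧ 0 < c ∧ ∀ n : ℕ, 1 ≤ n → c * (n : ℝ) ^ (-a) ≤ Literature.Probability.LatticeModels.criticalTwoPoint 3 ((n : ℤ) • (Pi.single 0 1 : Literature.Probability.LatticeModels.Site 3))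

/-- item stmt-CriticalPhenomena-1344 · crux · rank 4 · open · by planner
why it might fail: existence of the limit, rotation invariance and inversion covariance are each open on ℤ³ (Duminil-Copin ICM 2022 §8.4); Euclidean + scale data alone do not force Möbius covariance (barrier ScaleCovarianceNotMoebius) — delivered, if at all, by the covariance routes.
sources: DuminilCopinICM2022, Literature.Barriers.CriticalPhenomena.ScaleCovarianceNotMoebius, stmt-CriticalPhenomena-1344
[crux] r5 = MoebLim (IMPORTED COMPLEMENT, lowest rank): the critical Ising correlators on ℤ³ have a
non-degenerate pointwise scaling limit (ρ > 0 on (0,1], Δ > 0, S) that is Möbius covariant with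
dimension Δ — the conjunct Ising3DConformalLimit minus clause (iii). Written verbatim as the
conjunct's definiens without '∧ HasNontrivialU4 S' so that other routes filing the same complement
attach here. This route does not attack existence, rotation or inversion covariance; it bets on the
covariance lines (IsingEuclidUpgrade r5/r6 = items 0637/0638, IsingCFTData r2 = 0665, cards
hyperoctahedral-rp-rigidity / inversion-first-moebius-from-translations). S may be taken 0 off
NonCoincident, so no coincident-configuration junk obstructs the existential. -/
@[route_item "route-CriticalPhenomena-SubPtolemyInterlacing"]
def MoebiusLimit : Prop :=
  ∃ (ρ : ℝ → ℝ) (Δ : ℝ) (S : Literature.Probability.LatticeModels.CorrFamily 3), (∀ δ ∈ Set.Ioc (0:ℝ) 1, 0 < ρ δ) ∧ 0 < Δ ∧ Literature.Probability.LatticeModels.HasPointwiseScalingLimit (Literature.Probability.LatticeModels.criticalCorr 3) ρ S ∧ Literature.Probability.LatticeModels.IsNondegenerateTwoPoint S ∧ Literature.Probability.LatticeModels.IsMoebiusCovariant Δ S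

/-- item stmt-CriticalPhenomena-15704 · crux · rank 5 · closed · proved by Summit.CriticalPhenomena.Ising3DConformalLimit.Theorems.interlacingForcesU4_proof @ 5b616a3b85e2 (prover) · by planner
why it might fail: only through a formalisation gap — the latticeApprox bookkeeping (⌊k/δ⌋·e₁), limits of products along 𝓝[>]0 and the dyadic ratio argument must be redone for a lower bound (the in-tree scalingDimension_mem_Icc_of_bounds does both directions for exponents 1 and 2); mathematically a theorem.
sources: DuminilCopinICM2022, Simon1980, AizenmanCMP1982
[crux] (provable now; filed as a crux only because the deciding theorem may assume cruxes only)
Interlacing → SubPtolemyFloor → for every renormalisation ρ > 0 on (0,1], every Δ and every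
pointwise scaling limit S of criticalCorr 3 that is non-degenerate, translation invariant and scale
covariant with dimension Δ: HasNontrivialU4 S. Proof: SPC at the lattice approximants of x⁎ =
(0,2,3,6)·e₁ (gaps ⌊2/δ⌋, ⌊3/δ⌋−⌊2/δ⌋, ⌊6/δ⌋−⌊3/δ⌋ ≥ 1 for δ ≤ 1) × ρ(δ)⁸ passes to the limit;
translation + scale covariance give S₂ = κ·d^{-2Δ} on the axis (κ > 0), hence S₄(x⁎) ≤ κ²3^{-2Δ} and
U₄(x⁎) ≤ κ²3^{-2Δ}(1 − 2·2^{-2Δ} − 4^{-2Δ}); the dyadic argument of scalingDimension_mem_Icc_holds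
run with the floor (ρ(1/n)²G(n e₁) → κ, G(2n e₁)/G(n e₁) → 2^{-2Δ}, G(2^k N e₁) ≥ c(2^k N)^{-a})
gives 2Δ ≤ a < log₂(1+√2), where 2·2^{-2Δ} + 4^{-2Δ} > 1; so U₄(x⁎) < 0. [deps: Interlacing,
SubPtolemyFloor] [difficulty: provable-now] -/
@[route_item "route-CriticalPhenomena-SubPtolemyInterlacing"]
def InterlacingForcesU4 : Prop :=
  Interlacing → SubPtolemyFloor → ∀ (ρ : ℝ → ℝ) (Δ : ℝ) (S : Literature.Probability.LatticeModels.CorrFamily 3), (∀ δ ∈ Set.Ioc (0:ℝ) 1, 0 < ρ δ) → Literature.Probability.LatticeModels.HasPointwiseScalingLimit (Literature.Probability.LatticeModels.criticalCorr 3) ρ S → Literature.Probability.LatticeModels.IsNondegenerateTwoPoint S → Literature.Probability.LatticeModels.IsTranslationInvariant S → Literature.Probability.LatticeModels.IsScaleCovariant Δ S → Literature.Probability.LatticeModels.HasNontrivialU4 S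

-- `InterlacingForcesU4` holds: proved by `Summit.CriticalPhenomena.Ising3DConformalLimit.Theorems.interlacingForcesU4_proof` @ 5b616a3b85e2 (its module imports this route file, so no `_holds` link can be stated here).

/-- item stmt-CriticalPhenomena-18014 · aside · rank 2 · open · by planner
why it might fail: At z=½ it IS a scale-uniform merging floor P[interlaced critical currents merge] ≥ 0.45 ⇔ |U₄| ≥ 0.9·G₁₃G₂₄: non-Gaussianity of 3D Ising with a constant, open since 1982; only UPPER bounds on |U₄| exist (tree bound, AF86); margin 15 % is MC/bootstrap, uncertified.
sources: AizenmanCMP1982, AizenmanDuminilCopinAnnals2021, AizenmanFernandez1986, Aizenman2025, DuminilCopinICM2022, Lebowitz1974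
[crux] (SPC∞ — the EVENTUAL LARGE-GAP form of the sub-Ptolemy/interlacing inequality at the
Ptolemy-balanced cross-ratio z = ½, the only instance `closes` consumes) there is N₀ such that for
every N ≥ N₀ the critical + state correlations of the n.n. Ising model on ℤ³ satisfy, at the axis
quadruple x = (0, 2N, 3N, 6N)·e₁ (gaps (2N, N, 3N)),
⟨σ_{x₁}σ_{x₂}σ_{x₃}σ_{x₄}⟩·⟨σ_{x₁}σ_{x₃}⟩⟨σ_{x₂}σ_{x₄}⟩ ≤
⟨σ_{x₁}σ_{x₂}⟩⟨σ_{x₃}σ_{x₄}⟩·⟨σ_{x₁}σ_{x₄}⟩⟨σ_{x₂}σ_{x₃}⟩ (crossing pairing × S₄ ≤ product of the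
two non-crossing pairings; equality for the planar Ising CFT = Ptolemy, violated by the ℤ³ GFF).
RANDOM-CURRENT READING (landed reduction: Cruxes/Interlacing/Lines/Sketch.lean, Theorems
SubPtolemyInterlacingInterlacingBoxSwitching / BoxLimit / PatternForm, p129565 p129649 p129958): by
the switching lemma S₄ = P₁+P₂+P₃ − 2P₂·𝐏[the two INTERLACED sourced critical double currents ∂n₁ =
{x₁,x₃}, ∂n₂ = {x₂,x₄} merge] in the free box Λ_L, so the crux is EXACTLY a scale-uniform
interlaced-merging floor 𝐏[x₁ ↔ x₂ in n₁+n₂] ≥ ι*_L := 1 − (u_L−1)(t_L−1)/2 (u = P₁/P₂, t = P₃/P₂),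
eventually in L and in N (ι* → 0.448 in the continuum at 2Δ = 1.036; measured 𝐏[merge] = 0.78–0.83
and ρ := S₄P₂/(P₁P₃) = 0.76 -/
@[route_item "route-CriticalPhenomena-SubPtolemyInterlacing"]
def InterlacingEventualBalanced : Prop :=
  ∃ N₀ : ℕ, ∀ N : ℕ, N₀ ≤ N → 1 ≤ N → Literature.Probability.LatticeModels.criticalCorr 3 4 ![Pi.single 0 ((0 : ℕ) : ℤ), Pi.single 0 ((2 * N : ℕ) : ℤ), Pi.single 0 ((3 * N : ℕ) : ℤ), Pi.single 0 ((6 * N : ℕ) : ℤ)] * (Literature.Probability.LatticeModels.criticalCorr 3 2 ![Pi.single 0 ((0 : ℕ) : ℤ), Pi.single 0 ((3 * N : ℕ) : ℤ)] * Literature.Probability.LatticeModels.criticalCorr 3 2 ![Pi.single 0 ((2 * N : ℕ) : ℤ), Pi.single 0 ((6 * N : ℕ) : ℤ)]) ≤ Literature.Probability.LatticeModels.criticalCorr 3 2 ![Pi.single 0 ((0 : ℕ) : ℤ), Pi.single 0 ((2 * N : ℕ) : ℤ)] * Literature.Probability.LatticeModels.criticalCorr 3 2 ![Pi.single 0 ((3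 * N : ℕ) : ℤ), Pi.single 0 ((6 * N : ℕ) : ℤ)] * (Literature.Probability.LatticeModels.criticalCorr 3 2 ![Pi.single 0 ((0 : ℕ) : ℤ), Pi.single 0 ((6 * N : ℕ) : ℤ)] * Literature.Probability.LatticeModels.criticalCorr 3 2 ![Pi.single 0 ((2 * N : ℕ) : ℤ), Pi.single 0 ((3 * N : ℕ) : ℤ)])

/-- item stmt-CriticalPhenomena-15705 · aside · rank 9 · open · by planner
sources: AizenmanCMP1982, Lebowitz1974, FriedliVelenik2017
[support] (stronger, finite-volume-friendly form of SPC for idle provers/refuters) for every 0 ≤ β <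
β_c(3) and all a, b, c ≥ 1 the same interlacing inequality holds for the plus-state correlations
⟨σ_A⟩⁺_{β,0} on the axis quadruple (0, a, a+b, a+b+c)·e₁ — the regime with exponential decay, box
limits and the random-current/OZ toolbox, where the current form p_cross(1+q) ≤ p_s·p_t is a
disjoint-occurrence statement. [difficulty: L] -/
@[route_item "route-CriticalPhenomena-SubPtolemyInterlacing"]
def InterlacingSubcritical : Prop :=
  ∀ β : ℝ, 0 ≤ β → β < Literature.Probability.LatticeModels.criticalBeta 3 → ∀ a b c : ℕ, 1 ≤ a → 1 ≤ b → 1 ≤ c → let p : ℕ → Literature.Probability.LatticeModels.Site 3 := fun k => (k : ℤ) • (Pi.single 0 1 : Literature.Probability.LatticeModels.Site 3); Literature.Probability.LatticeModels.plusCorr 3 β 0 {p 0, p a, p (a + b), p (a + b + c)} * (Literature.Probability.LatticeModels.plusCorr 3 β 0 {p 0, p (a + b)} * Literature.Probability.LatticeModels.plusCorr 3 β 0 {p a, p (a + b + c)}) ≤ Literature.Probability.LatticeModels.plusCorr 3 β 0 {p 0, p a} * Literature.Probability.LatticeModels.plusCorr 3 β 0 {p (a + b), p (a + b + c)} * (Literature.Probability.LatticeModels.plusCorr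 3 β 0 {p 0, p (a + b + c)} * Literature.Probability.LatticeModels.plusCorr 3 β 0 {p a, p (a + b)})

/-- item stmt-CriticalPhenomena-15706 · support · rank 9 · closed · proved by Summit.CriticalPhenomena.Ising3DConformalLimit.Theorems.subcriticalSuffices_proof @ d5b3c2c27416 (prover) · by planner
sources: AizenmanDuminilCopinSidoraviciusCMP2015, FriedliVelenik2017
[support] (provable now) InterlacingSubcritical → Interlacing: plus-state correlations of finite
spin sets are left-continuous at β_c(3) — ⟨σ_A⟩^free_β ≤ ⟨σ_A⟩⁺_β ≤ ⟨σ_A⟩⁺_{β_c} for β < β_c (GKS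
monotonicity in β), the free state is a supremum of continuous non-decreasing box functions hence
left-continuous, and free = plus at β_c (criticalCorr_wellDefined_holds / uniqueness at β_c,
AizenmanDuminilCopinSidoraviciusCMP2015) — so the non-strict inequality passes to β_c; spinMonomial
of four distinct axis sites = spinProduct of the 4-set. [difficulty: provable-now] -/
@[route_item "route-CriticalPhenomena-SubPtolemyInterlacing"]
def SubcriticalSuffices : Prop :=
  InterlacingSubcritical → Interlacing

-- `SubcriticalSuffices` holds: proved by `Summit.CriticalPhenomena.Ising3DConformalLimit.Theorems.subcriticalSuffices_proof` @ d5b3c2c27416 (its module imports this route file, so no `_holds` link can be stated here).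

/-- item stmt-CriticalPhenomena-18015 · support · rank 9 · open · by planner
sources: DuminilCopinICM2022, AizenmanCMP1982, Simon1980
[support] (glue, PROVABLE NOW — two lines from the landed transfer file
Theorems/SubPtolemyInterlacingInterlacingBalancedSuffices.lean, p140149: `fun ⟨N₀, h⟩ hF =>
transfer_hasNontrivialU4_of_eventualBalanced (transfer_eventualBalanced_of_balanced N₀ h) hF`;
certified rc 0, axioms propext/Classical.choice/Quot.sound, as `eventualBalancedForcesU4_cert` in
the planner's Sketch.lean attached as evidence) InterlacingEventualBalanced → SubPtolemyFloor → for
every renormalisation ρ > 0 on (0,1], every Δ and every pointwise scaling limit S of criticalCorr 3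
that is non-degenerate, translation invariant and scale covariant with dimension Δ: HasNontrivialU4
S (indeed U₄((0,2,3,6)·e₁) < 0: SPC∞ passes to the limit along N = 2^{k+1}; translation + scale
covariance give S₂ = κ·d^{−2Δ} on the axis; the floor and the dyadic ratio argument give 2Δ ≤ a <
log₂(1+√2), exactly where 2·2^{−2Δ} + 4^{−2Δ} > 1). Replaces the proved InterlacingForcesU4
(antecedent = the banked all-gaps form) as the glue hypothesis of `closes`. [deps:
InterlacingEventualBalanced, SubPtolemyFloor] [difficulty: provable-now] -/
@[route_item "route-CriticalPhenomena-SubPtolemyInterlacing"]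
def EventualBalancedForcesU4 : Prop :=
  InterlacingEventualBalanced → SubPtolemyFloor → ∀ (ρ : ℝ → ℝ) (Δ : ℝ) (S : Literature.Probability.LatticeModels.CorrFamily 3), (∀ δ ∈ Set.Ioc (0:ℝ) 1, 0 < ρ δ) → Literature.Probability.LatticeModels.HasPointwiseScalingLimit (Literature.Probability.LatticeModels.criticalCorr 3) ρ S → Literature.Probability.LatticeModels.IsNondegenerateTwoPoint S → Literature.Probability.LatticeModels.IsTranslationInvariant S → Literature.Probability.LatticeModels.IsScaleCovariant Δ S → Literature.Probability.LatticeModels.HasNontrivialU4 S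

/-- item stmt-CriticalPhenomena-15707 · assembly · rank 1 · closed · proved by Summit.CriticalPhenomena.Ising3DConformalLimit.Theorems.subPtolemyInterlacing_assembly_proof @ bf7768c89cf0 (prover) · by planner
sources: DuminilCopinICM2022, AizenmanCMP1982
[assembly] Interlacing → SubPtolemyFloor → MoebiusLimit → InterlacingForcesU4 →
Ising3DConformalLimit. -/
@[route_item "route-CriticalPhenomena-SubPtolemyInterlacing"]
def Assembly : Prop :=
  Interlacing → SubPtolemyFloor → MoebiusLimit → InterlacingForcesU4 → _root_.Ising3DConformalLimit

-- `Assembly` holds: proved by `Summit.CriticalPhenomena.Ising3DConformalLimit.Theorems.subPtolemyInterlacing_assembly_proof` @ bf7768c89cf0 (its module imports this route file, so no `_holds` link can be stated here).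

/-! D-0027 §2.1 — DECIDING THEOREM (planner-authored via `route open/edit --closes-file`; by planner-plan-novel-CriticalPhenomena-Ising3DCon-3ad144fc-v2- 2026-08-16T15:52:45Z):
its hypotheses are this route's items and its conclusion the sub-problem Statement (glue_lint), and it elaborates with this file. -/

@[closes "route-CriticalPhenomena-SubPtolemyInterlacing"] theorem closes (hI : Interlacing) (hF : SubPtolemyFloor) (hML : MoebiusLimit) (hU : InterlacingForcesU4) : _root_.Ising3DConformalLimit := by
  obtain ⟨ρ, Δ, S, hρ, hΔ, hlim, hnd, hmob⟩ := hML
  exact ⟨ρ, Δ, S, hρ, hΔ, hlim, hnd, hmob, hU hI hF ρ Δ S hρ hlim hnd hmob.1.1 hmob.2.1⟩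

end Summit.CriticalPhenomena.Ising3DConformalLimit.Theses.SubPtolemyInterlacing
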